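import Summits.FinalStateConjecture.FinalStateConjecture.Theorems.EIHFluxBalanceInertialRecessionStubSlavingCOERLieKernel
import Summits.FinalStateConjecture.FinalStateConjecture.Theorems.EIHFluxBalanceInertialRecessionLorentz
import Literature.Geometry.Lorentzian.KerrAxialSymmetryCovariant
import Literature.Geometry.Lorentzian.KerrConvergenceProofs
import Literature.Geometry.Lorentzian.MinkowskiSimplexFit

/-!
# Route EIHFluxBalance — `InertialRecession` (E′), skeleton r13, stub `stub_firstOrderSlaving` (D),
# part 2: the rest-frame first variation of `g_{M,a}` — Killing kernel and reduction to visible rates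

Helper file for the crux `stmt-FinalStateConjecture-17403` (E′), stub (D). The rest-frame first
variation of `g = g_{M,a}` under the infinitesimal Poincaré motion `(A, d)` (`A` `η`-skew) at `y` is
`∂_{Ay + d} g(v, w) + g(Av, w) + g(v, Aw)`. Time translations (`firstOrder_fderiv_kerr_basisVector_zero`)
and the axial rotation (`firstOrder_lie_axial_eq_zero`, every spin) are Killing, as are all rotations
for `a = 0` (`lieDeriv_bilin_zero_spin_rotation_eq_zero`); `firstOrder_lie_reduce` removes these
invisible rates: the same first variation is produced by `(A', d')` with
`‖A'‖ + ‖d'‖ ≤ 4 (1 + |a|⁻¹) (‖A e₀‖ + ‖d~‖ + ‖a · A e₃‖)`. Elementary; no definitions, no named facts.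
-/

set_option linter.dupNamespace false
set_option maxSynthPendingDepth 3

noncomputable section

open scoped Topology InnerProductSpace
open Filter Set Function Literature.Geometry.Lorentzian Literature.Geometry.Lorentzian.Schwarzschild
  Summit.FinalStateConjecture.FinalStateConjecture.Theorems

namespace Summit.FinalStateConjecture.FinalStateConjecture.Theorems.SublinearIsFree.Slaving

/-! ### Coordinates -/

/-- Operator norm from the columns: `‖A‖ ≤ Σ_μ ‖A e_μ‖`. [folklore] -/
theorem firstOrder_opNorm_le_sum_columns (A : E4 →L[ℝ] E4) :
    ‖A‖ ≤ ‖A (E4.basisVector 0)‖ + ‖A (E4.basisVector 1)‖ + ‖A (E4.basisVector 2)‖ +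
      ‖A (E4.basisVector 3)‖ := by
  refine ContinuousLinearMap.opNorm_le_bound _ (by positivity) fun v ↦ ?_
  have h : v = ∑ μ, v μ • E4.basisVector μ := Kerr.eq_sum_basisVector v
  have hAv : A v = v 0 • A (E4.basisVector 0) + v 1 • A (E4.basisVector 1) +
      v 2 • A (E4.basisVector 2) + v 3 • A (E4.basisVector 3) := by
    have := congrArg A h
    rw [this]
    simp only [map_add, map_smul, Fin.sum_univ_four]
  rw [hAv]
  have h0 := MinkowskiSimplex.abs_apply_le_norm v 0
  have h1 := MinkowskiSimplex.abs_apply_le_norm v 1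
  have h2 := MinkowskiSimplex.abs_apply_le_norm v 2
  have h3 := MinkowskiSimplex.abs_apply_le_norm v 3
  calc ‖v 0 • A (E4.basisVector 0) + v 1 • A (E4.basisVector 1) + v 2 • A (E4.basisVector 2) +
        v 3 • A (E4.basisVector 3)‖
      ≤ ‖v 0 • A (E4.basisVector 0) + v 1 • A (E4.basisVector 1) + v 2 • A (E4.basisVector 2)‖ +
        ‖v 3 • A (E4.basisVector 3)‖ := norm_add_le _ _
    _ ≤ ‖v 0 • A (E4.basisVector 0) + v 1 • A (E4.basisVector 1)‖ + ‖v 2 • A (E4.basisVector 2)‖ +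
        ‖v 3 • A (E4.basisVector 3)‖ := by gcongr; exact norm_add_le _ _
    _ ≤ ‖v 0 • A (E4.basisVector 0)‖ + ‖v 1 • A (E4.basisVector 1)‖ + ‖v 2 • A (E4.basisVector 2)‖ +
        ‖v 3 • A (E4.basisVector 3)‖ := by gcongr; exact norm_add_le _ _
    _ = |v 0| * ‖A (E4.basisVector 0)‖ + |v 1| * ‖A (E4.basisVector 1)‖ +
        |v 2| * ‖A (E4.basisVector 2)‖ + |v 3| * ‖A (E4.basisVector 3)‖ := by
        simp only [norm_smul, Real.norm_eq_abs]
    _ ≤ ‖v‖ * ‖A (E4.basisVector 0)‖ + ‖v‖ * ‖A (E4.basisVector 1)‖ +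
        ‖v‖ * ‖A (E4.basisVector 2)‖ + ‖v‖ * ‖A (E4.basisVector 3)‖ := by
        gcongr
    _ = _ := by ring

/-! ### Time translations and the axial rotation are Killing -/

/-- **Time translations are Killing**: `∂_{e₀} g_{M,a}(y) = 0` (the Kerr–Schild components depend
on the spatial coordinates only; Kerr–Schild 1965, §2). [cite: KerrSchild1965, §2] -/
theorem firstOrder_fderiv_kerr_basisVector_zero (M a : ℝ) (y : E4) :
    fderiv ℝ (Kerr.bilin M a) y (E4.basisVector 0) = 0 := by
  by_cases hd : DifferentiableAt ℝ (Kerr.bilin M a) y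
  · have hpath : HasDerivAt (fun s : ℝ ↦ y + s • E4.basisVector 0) (E4.basisVector 0) 0 := by
      simpa using ((hasDerivAt_id (0 : ℝ)).smul_const (E4.basisVector 0)).const_add y
    have h1 : HasDerivAt (fun s : ℝ ↦ Kerr.bilin M a (y + s • E4.basisVector 0))
        (fderiv ℝ (Kerr.bilin M a) y (E4.basisVector 0)) 0 :=
      hd.hasFDerivAt.comp_hasDerivAt_of_eq 0 hpath (by simp)
    have hconst : (fun s : ℝ ↦ Kerr.bilin M a (y + s • E4.basisVector 0)) =
        fun _ ↦ Kerr.bilin M a y := by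
      funext s
      have hsp : E4.spatial (y + s • E4.basisVector 0) = E4.spatial y := by
        have h0 : E4.spatial (E4.basisVector 0) = 0 := by
          ext i; simp
        rw [map_add, map_smul, h0, smul_zero, add_zero]
      have := Kerr.ksPert_eq_of_spatial_eq M a hsp
      exact sub_left_injective this
    rw [hconst] at h1
    exact (h1.unique (hasDerivAt_const 0 _)).symm ▸ rfl
  · rw [fderiv_zero_of_not_differentiableAt hd, zero_apply]

/-- The axial flow in the basis: `R_α x = x⁰e₀ + (cos α x¹ − sin α x²)e₁ + (sin α x¹ + cos α x²)e₂ + x³e₃`.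
[folklore] -/
theorem firstOrder_axialRotation_eq (α : ℝ) (x : E4) :
    E4.axialRotation α x = x 0 • E4.basisVector 0 +
      (Real.cos α * x 1 - Real.sin α * x 2) • E4.basisVector 1 +
      (Real.sin α * x 1 + Real.cos α * x 2) • E4.basisVector 2 + x 3 • E4.basisVector 3 := by
  ext i
  fin_cases i <;> simp

/-- **The axial generator**: `d/dα|₀ R_α x = x¹ e₂ − x² e₁`. [folklore] -/
theorem firstOrder_hasDerivAt_axialRotation (x : E4) :
    HasDerivAt (fun α ↦ E4.axialRotation α x)
      (x 1 • E4.basisVector 2 - x 2 • E4.basisVector 1) 0 := by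
  have hfun : (fun α ↦ E4.axialRotation α x) = fun α ↦ x 0 • E4.basisVector 0 +
      (Real.cos α * x 1 - Real.sin α * x 2) • E4.basisVector 1 +
      (Real.sin α * x 1 + Real.cos α * x 2) • E4.basisVector 2 + x 3 • E4.basisVector 3 :=
    funext fun α ↦ firstOrder_axialRotation_eq α x
  rw [hfun]
  have hc := Real.hasDerivAt_cos (0 : ℝ)
  have hs := Real.hasDerivAt_sin (0 : ℝ)
  have h1 : HasDerivAt (fun α ↦ Real.cos α * x 1 - Real.sin α * x 2) (-(x 2)) 0 :=
    ((hc.mul_const (x 1)).sub (hs.mul_const (x 2))).congr_deriv (by simp)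
  have h2 : HasDerivAt (fun α ↦ Real.sin α * x 1 + Real.cos α * x 2) (x 1) 0 :=
    ((hs.mul_const (x 1)).add (hc.mul_const (x 2))).congr_deriv (by simp)
  have hall := (((hasDerivAt_const (0 : ℝ) (x 0 • E4.basisVector 0)).add
    (h1.smul_const (E4.basisVector 1))).add (h2.smul_const (E4.basisVector 2))).add
    (hasDerivAt_const (0 : ℝ) (x 3 • E4.basisVector 3))
  refine hall.congr_deriv ?_
  simp only [zero_add, add_zero, neg_smul]
  abel

/-- **The axial rotation is Killing for every spin**:
`∂_{R₃ y} g(v, w) + g(R₃ v, w) + g(v, R₃ w) = 0`, `R₃ u = u¹ e₂ − u² e₁`, wherever `r_a(y) > 0`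
(derivative at `α = 0` of `g(R_α y)(R_α v, R_α w) = g(y)(v, w)`, `Kerr.bilin_axialRotation`;
O'Neill 1995, Ch. 2, §2.2). [cite: ONeill1995, Ch. 2 §2.2] -/
theorem firstOrder_lie_axial_eq_zero (M a : ℝ) {y : E4} (hy : 0 < Kerr.radius a y) (v w : E4) :
    fderiv ℝ (Kerr.bilin M a) y (y 1 • E4.basisVector 2 - y 2 • E4.basisVector 1) v w +
      Kerr.bilin M a y (v 1 • E4.basisVector 2 - v 2 • E4.basisVector 1) w +
      Kerr.bilin M a y v (w 1 • E4.basisVector 2 - w 2 • E4.basisVector 1) = 0 := by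
  set R : ℝ → E4 → E4 := fun α x ↦ E4.axialRotation α x with hR
  have hR0 : ∀ x, R 0 x = x := fun x ↦ by simp [hR]
  have hK : HasFDerivAt (Kerr.bilin M a) (fderiv ℝ (Kerr.bilin M a) y) y :=
    ((Kerr.contDiffAt_bilin M a hy (n := 1)).differentiableAt one_ne_zero).hasFDerivAt
  have hy' : HasDerivAt (fun α ↦ R α y) (y 1 • E4.basisVector 2 - y 2 • E4.basisVector 1) 0 :=
    firstOrder_hasDerivAt_axialRotation y
  have hv' : HasDerivAt (fun α ↦ R α v) (v 1 • E4.basisVector 2 - v 2 • E4.basisVector 1) 0 :=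
    firstOrder_hasDerivAt_axialRotation v
  have hw' : HasDerivAt (fun α ↦ R α w) (w 1 • E4.basisVector 2 - w 2 • E4.basisVector 1) 0 :=
    firstOrder_hasDerivAt_axialRotation w
  have h1 : HasDerivAt (fun α ↦ Kerr.bilin M a (R α y))
      (fderiv ℝ (Kerr.bilin M a) y (y 1 • E4.basisVector 2 - y 2 • E4.basisVector 1)) 0 :=
    hK.comp_hasDerivAt_of_eq 0 hy' (hR0 y).symm
  have h2 := (h1.clm_apply hv').clm_apply hw'
  have hconst : (fun α ↦ Kerr.bilin M a (R α y) (R α v) (R α w)) = fun _ ↦ Kerr.bilin M a y v w :=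
    funext fun α ↦ Kerr.bilin_axialRotation M a α y v w
  rw [hconst] at h2
  have h3 := h2.unique (hasDerivAt_const 0 _)
  simp only [hR0, add_apply] at h3
  linarith [h3]

/-! ### `η`-skew operators: coordinates, the axial generator, the boost part -/

/-- **Entries of an `η`-skew operator**: `(Ae₀)⁰ = 0`, `(Ae₁)⁰ = (Ae₀)¹`, `(Ae₂)⁰ = (Ae₀)²`,
`(Ae₁)¹ = (Ae₂)² = 0`, `(Ae₂)¹ = −(Ae₁)²`, `(Ae₁)³ = −(Ae₃)¹`, `(Ae₂)³ = −(Ae₃)²`. [folklore] -/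
theorem firstOrder_skew_entries {A : E4 →L[ℝ] E4}
    (hA : ∀ u w : E4, Minkowski.bilin (A u) w + Minkowski.bilin u (A w) = 0) :
    A (E4.basisVector 0) 0 = 0 ∧ A (E4.basisVector 1) 0 = A (E4.basisVector 0) 1 ∧
    A (E4.basisVector 2) 0 = A (E4.basisVector 0) 2 ∧ A (E4.basisVector 1) 1 = 0 ∧
    A (E4.basisVector 2) 2 = 0 ∧ A (E4.basisVector 2) 1 = -A (E4.basisVector 1) 2 ∧
    A (E4.basisVector 1) 3 = -A (E4.basisVector 3) 1 ∧ A (E4.basisVector 2) 3 = -A (E4.basisVector 3) 2 := by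
  have e3 : (2 : Fin 3).succ = (3 : Fin 4) := rfl
  have h00 := hA (E4.basisVector 0) (E4.basisVector 0); have h01 := hA (E4.basisVector 0) (E4.basisVector 1)
  have h02 := hA (E4.basisVector 0) (E4.basisVector 2); have h11 := hA (E4.basisVector 1) (E4.basisVector 1)
  have h22 := hA (E4.basisVector 2) (E4.basisVector 2); have h12 := hA (E4.basisVector 1) (E4.basisVector 2)
  have h13 := hA (E4.basisVector 1) (E4.basisVector 3); have h23 := hA (E4.basisVector 2) (E4.basisVector 3)
  simp [Fin.sum_univ_three, e3] at h00 h01 h02 h11 h22 h12 h13 h23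
  refine ⟨?_, ?_, ?_, ?_, ?_, ?_, ?_, ?_⟩ <;> linarith

/-- The axial generator `R₃ u = u¹ e₂ − u² e₁` is `η`-skew. [folklore] -/
theorem firstOrder_axialGen_skew (u w : E4) :
    Minkowski.bilin (u 1 • E4.basisVector 2 - u 2 • E4.basisVector 1) w +
      Minkowski.bilin u (w 1 • E4.basisVector 2 - w 2 • E4.basisVector 1) = 0 := by
  have e3 : (2 : Fin 3).succ = (3 : Fin 4) := rfl
  simp [Fin.sum_univ_three, e3]

/-- **The axial reduction of an `η`-skew operator**: with `ω = (Ae₁)²`, the operator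
`A' = A − ω R₃` satisfies `‖A'‖ ≤ 3 (‖A e₀‖ + ‖A e₃‖)` (its columns are `Ae₀`, `Ae₃`, and two columns
with entries among `±(Ae₀)ʲ`, `±(Ae₃)ʲ`). [folklore] -/
theorem firstOrder_norm_axialReduce_le {A : E4 →L[ℝ] E4}
    (hA : ∀ u w : E4, Minkowski.bilin (A u) w + Minkowski.bilin u (A w) = 0) :
    ‖A - (A (E4.basisVector 1) 2) • ((E4.dx 1).smulRight (E4.basisVector 2) -
        (E4.dx 2).smulRight (E4.basisVector 1))‖ ≤
      3 * (‖A (E4.basisVector 0)‖ + ‖A (E4.basisVector 3)‖) := by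
  obtain ⟨-, h10, h20, h11, h22, h21, h13, h23⟩ := firstOrder_skew_entries hA
  set ω : ℝ := A (E4.basisVector 1) 2 with hω
  set R : E4 →L[ℝ] E4 := (E4.dx 1).smulRight (E4.basisVector 2) - (E4.dx 2).smulRight (E4.basisVector 1)
    with hR
  have hRap : ∀ u : E4, R u = u 1 • E4.basisVector 2 - u 2 • E4.basisVector 1 := fun u ↦ by
    simp [hR]
  set A' := A - ω • R with hA'
  have hc0 : A' (E4.basisVector 0) = A (E4.basisVector 0) := by simp [hA', hR]
  have hc3 : A' (E4.basisVector 3) = A (E4.basisVector 3) := by simp [hA', hR]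
  have n0 := MinkowskiSimplex.abs_apply_le_norm (A (E4.basisVector 0))
  have n3 := MinkowskiSimplex.abs_apply_le_norm (A (E4.basisVector 3))
  have hc1 : ‖A' (E4.basisVector 1)‖ ≤ ‖A (E4.basisVector 0)‖ + ‖A (E4.basisVector 3)‖ := by
    refine (MinkowskiSimplex.norm_le_sum_abs _).trans ?_
    have q : ∀ μ : Fin 4, A' (E4.basisVector 1) μ = A (E4.basisVector 1) μ - ω * (E4.basisVector 2 : E4) μ := by
      intro μ; simp [hA', hR]
    simp only [q]
    rw [h10, h11, h13]
    simp [hω]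
    linarith [n0 1, n3 1]
  have hc2 : ‖A' (E4.basisVector 2)‖ ≤ ‖A (E4.basisVector 0)‖ + ‖A (E4.basisVector 3)‖ := by
    refine (MinkowskiSimplex.norm_le_sum_abs _).trans ?_
    have q : ∀ μ : Fin 4, A' (E4.basisVector 2) μ = A (E4.basisVector 2) μ + ω * (E4.basisVector 1 : E4) μ := by
      intro μ; simp [hA', hR]
    simp only [q]
    rw [h20, h22, h23, h21]
    simp [hω]
    linarith [n0 2, n3 2]
  calc ‖A'‖ ≤ ‖A' (E4.basisVector 0)‖ + ‖A' (E4.basisVector 1)‖ + ‖A' (E4.basisVector 2)‖ +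
        ‖A' (E4.basisVector 3)‖ := firstOrder_opNorm_le_sum_columns A'
    _ ≤ ‖A (E4.basisVector 0)‖ + (‖A (E4.basisVector 0)‖ + ‖A (E4.basisVector 3)‖) +
        (‖A (E4.basisVector 0)‖ + ‖A (E4.basisVector 3)‖) + ‖A (E4.basisVector 3)‖ := by
        rw [hc0, hc3]; gcongr
    _ = 3 * (‖A (E4.basisVector 0)‖ + ‖A (E4.basisVector 3)‖) := by ring

/-- **The boost part of an `η`-skew operator** (`skew_decomposition`): with `p = A e₀`, the operator
`B u = u⁰ p + ⟪p⃗, u⃗⟫ e₀` is `η`-skew, `‖B‖ ≤ 2‖A e₀‖`, and `A − B` is a spatial rotation generator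
(`(A − B)u` is spatial and `u ↦ ((A − B)u)⃗` is skew). [folklore] -/
theorem firstOrder_boostPart {A : E4 →L[ℝ] E4}
    (hA : ∀ u w : E4, Minkowski.bilin (A u) w + Minkowski.bilin u (A w) = 0) :
    (∀ u w : E4, Minkowski.bilin (((E4.dx 0).smulRight (A (E4.basisVector 0)) +
        ((innerSL ℝ (E4.spatial (A (E4.basisVector 0)))).comp E4.spatial).smulRight
          (E4.basisVector 0)) u) w +
      Minkowski.bilin u (((E4.dx 0).smulRight (A (E4.basisVector 0)) +
        ((innerSL ℝ (E4.spatial (A (E4.basisVector 0)))).comp E4.spatial).smulRight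
          (E4.basisVector 0)) w) = 0) ∧
    ‖(E4.dx 0).smulRight (A (E4.basisVector 0)) +
        ((innerSL ℝ (E4.spatial (A (E4.basisVector 0)))).comp E4.spatial).smulRight
          (E4.basisVector 0)‖ ≤ 2 * ‖A (E4.basisVector 0)‖ ∧
    (∀ u : E4, (A u - ((E4.dx 0).smulRight (A (E4.basisVector 0)) +
        ((innerSL ℝ (E4.spatial (A (E4.basisVector 0)))).comp E4.spatial).smulRight
          (E4.basisVector 0)) u) 0 = 0) ∧
    (∀ u w : E4, sdot (A u - ((E4.dx 0).smulRight (A (E4.basisVector 0)) +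
        ((innerSL ℝ (E4.spatial (A (E4.basisVector 0)))).comp E4.spatial).smulRight
          (E4.basisVector 0)) u) w =
      -sdot u (A w - ((E4.dx 0).smulRight (A (E4.basisVector 0)) +
        ((innerSL ℝ (E4.spatial (A (E4.basisVector 0)))).comp E4.spatial).smulRight
          (E4.basisVector 0)) w)) := by
  obtain ⟨hp0, hρ0, -, hρskew⟩ := skew_decomposition hA
  have h10 : E4.ofTimeSpace 1 (0 : E3) = E4.basisVector 0 := by
    ext i; refine Fin.cases ?_ (fun j ↦ ?_) i <;> simp [Fin.succ_ne_zero]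
  have hsple : ∀ u : E4, ‖E4.spatial u‖ ≤ ‖u‖ := fun u ↦ by
    have h := norm_sq_eq_sq_add_spatialNorm_sq u
    rw [E4.spatialNorm] at h
    nlinarith [norm_nonneg u, norm_nonneg (E4.spatial u), sq_nonneg (u 0)]
  rw [h10] at hp0 hρ0 hρskew
  set p : E4 := A (E4.basisVector 0) with hp
  set B : E4 →L[ℝ] E4 := (E4.dx 0).smulRight p +
    ((innerSL ℝ (E4.spatial p)).comp E4.spatial).smulRight (E4.basisVector 0) with hB
  have hBap : ∀ u : E4, B u = u 0 • p + ⟪E4.spatial p, E4.spatial u⟫_ℝ • E4.basisVector 0 := by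
    intro u; simp [hB]
  have hBeq : ∀ u : E4, B u = E4.ofTimeSpace (sdot p u) (u 0 • E4.spatial p) := by
    intro u
    rw [hBap]
    ext i
    refine Fin.cases ?_ (fun j ↦ ?_) i
    · simp [hp0, sdot]
    · simp [Fin.succ_ne_zero, sdot]
  have hηp : ∀ w : E4, Minkowski.bilin p w = sdot p w := fun w ↦ by
    rw [Minkowski.bilin_symm, minkowski_bilin_of_apply_zero_eq_zero w hp0, sdot, real_inner_comm]
  have hηe : ∀ w : E4, Minkowski.bilin (E4.basisVector 0) w = -w 0 :=
    minkowski_bilin_basisVector_zero_left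
  refine ⟨fun u w ↦ ?_, ?_, fun u ↦ ?_, fun u w ↦ ?_⟩
  · rw [hBap, hBap, Minkowski.bilin_symm u]
    simp only [map_add, map_smul, add_apply, smul_apply, smul_eq_mul, hηp, hηe]
    simp only [sdot]
    ring
  · refine ContinuousLinearMap.opNorm_le_bound _ (by positivity) fun u ↦ ?_
    rw [hBap]
    have h1 : ‖u 0 • p‖ ≤ ‖u‖ * ‖p‖ := by
      rw [norm_smul, Real.norm_eq_abs]
      exact mul_le_mul_of_nonneg_right (MinkowskiSimplex.abs_apply_le_norm u 0) (norm_nonneg _)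
    have h2 : ‖⟪E4.spatial p, E4.spatial u⟫_ℝ • E4.basisVector 0‖ ≤ ‖p‖ * ‖u‖ := by
      rw [norm_smul, show ‖E4.basisVector 0‖ = 1 by simp, mul_one]
      refine (abs_real_inner_le_norm _ _).trans ?_
      exact mul_le_mul (hsple p) (hsple u) (norm_nonneg _)
        (norm_nonneg _)
    calc ‖u 0 • p + ⟪E4.spatial p, E4.spatial u⟫_ℝ • E4.basisVector 0‖
        ≤ ‖u 0 • p‖ + ‖⟪E4.spatial p, E4.spatial u⟫_ℝ • E4.basisVector 0‖ := norm_add_le _ _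
      _ ≤ ‖u‖ * ‖p‖ + ‖p‖ * ‖u‖ := add_le_add h1 h2
      _ = 2 * ‖p‖ * ‖u‖ := by ring
  · rw [hBeq]; exact hρ0 u
  · rw [hBeq, hBeq]; exact hρskew u w

/-! ### Reduction of the first variation to the visible body rates -/

/-- **Reduction of the rest-frame first variation to the visible rates.** For an `η`-skew `A` and
any `d` there are an `η`-skew `A'` and `d'` with
`‖A'‖ + ‖d'‖ ≤ 4 (1 + |a|⁻¹) (‖A e₀‖ + ‖d~‖ + ‖a · A e₃‖)` and the same first variation
`∂_{Ay+d} g(v,w) + g(Av,w) + g(v,Aw)` of `g = g_{M,a}` at every `y` with `r_a(y) > 0`: subtract the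
time translation `d⁰ e₀` (`firstOrder_fderiv_kerr_basisVector_zero`), the axial rotation
`(Ae₁)² R₃` (`firstOrder_lie_axial_eq_zero`) and, for `a = 0`, the whole rotation part
(`lieDeriv_bilin_zero_spin_rotation_eq_zero`). The invisible rates are exactly the Killing
directions of Kerr (O'Neill 1995, Ch. 2, §2.2). [cite: ONeill1995, Ch. 2 §2.2] -/
theorem firstOrder_lie_reduce (M a : ℝ) {A : E4 →L[ℝ] E4}
    (hA : ∀ u w : E4, Minkowski.bilin (A u) w + Minkowski.bilin u (A w) = 0) (d : E4) :
    ∃ (A' : E4 →L[ℝ] E4) (d' : E4),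
      (∀ u w : E4, Minkowski.bilin (A' u) w + Minkowski.bilin u (A' w) = 0) ∧
      ‖A'‖ + ‖d'‖ ≤ 4 * (1 + |a|⁻¹) *
        (‖A (E4.basisVector 0)‖ + ‖E4.spatial d‖ + ‖a • A (E4.basisVector 3)‖) ∧
      ∀ y : E4, 0 < Kerr.radius a y → ∀ v w : E4,
        fderiv ℝ (Kerr.bilin M a) y (A y + d) v w + Kerr.bilin M a y (A v) w +
            Kerr.bilin M a y v (A w) =
          fderiv ℝ (Kerr.bilin M a) y (A' y + d') v w + Kerr.bilin M a y (A' v) w +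
            Kerr.bilin M a y v (A' w) := by
  set d' : E4 := E4.ofTimeSpace 0 (E4.spatial d) with hd'
  have hd'0 : d' 0 = 0 := by simp [hd']
  have hnd' : ‖d'‖ = ‖E4.spatial d‖ := by
    rw [norm_eq_spatialNorm_of_apply_zero_eq_zero hd'0, hd', E4.spatialNorm_ofTimeSpace]
  have hdsplit : d = d' + d 0 • E4.basisVector 0 := by
    ext i
    refine Fin.cases ?_ (fun j ↦ ?_) i <;> simp [hd', Fin.succ_ne_zero]
  have htime : ∀ y v w : E4, fderiv ℝ (Kerr.bilin M a) y (d 0 • E4.basisVector 0) v w = 0 := by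
    intro y v w
    rw [map_smul, firstOrder_fderiv_kerr_basisVector_zero, smul_zero, zero_apply, zero_apply]
  have h0 : 0 ≤ ‖A (E4.basisVector 0)‖ := norm_nonneg _; have h1 : 0 ≤ ‖E4.spatial d‖ := norm_nonneg _
  have h3 : 0 ≤ ‖a • A (E4.basisVector 3)‖ := norm_nonneg _; have hai : 0 ≤ |a|⁻¹ := by positivity
  by_cases ha : a = 0
  · -- Schwarzschild: remove the whole rotation part
    subst ha
    obtain ⟨hBskew, hBnorm, hρ0, hρskew⟩ := firstOrder_boostPart hA
    set B : E4 →L[ℝ] E4 := (E4.dx 0).smulRight (A (E4.basisVector 0)) +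
      ((innerSL ℝ (E4.spatial (A (E4.basisVector 0)))).comp E4.spatial).smulRight
        (E4.basisVector 0) with hB
    refine ⟨B, d', hBskew, ?_, fun y hy v w ↦ ?_⟩
    · rw [abs_zero, inv_zero, add_zero, mul_one]
      linarith
    · have hsp : E4.spatial y ≠ 0 := by
        rw [Kerr.radius_zero_left, E4.spatialNorm] at hy
        exact norm_pos_iff.1 hy
      have hker := lieDeriv_bilin_zero_spin_rotation_eq_zero M hsp (R := fun u ↦ A u - B u)
        hρ0 hρskew v w
      have hy' : A y + d = (B y + d') + ((A y - B y) + d 0 • E4.basisVector 0) := by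
        conv_lhs => rw [hdsplit]
        abel
      have hv' : A v = B v + (A v - B v) := by abel
      have hw' : A w = B w + (A w - B w) := by abel
      rw [hy', hv', hw']
      simp only [map_add, add_apply, htime]
      linarith [hker]
  · -- Kerr: remove the axial rotation only
    set ω : ℝ := A (E4.basisVector 1) 2 with hω
    set R : E4 →L[ℝ] E4 := (E4.dx 1).smulRight (E4.basisVector 2) -
      (E4.dx 2).smulRight (E4.basisVector 1) with hR
    have hRap : ∀ u : E4, R u = u 1 • E4.basisVector 2 - u 2 • E4.basisVector 1 := fun u ↦ by
      simp [hR]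
    refine ⟨A - ω • R, d', fun u w ↦ ?_, ?_, fun y hy v w ↦ ?_⟩
    · have h := hA u w
      have hr := firstOrder_axialGen_skew u w
      rw [← hRap u, ← hRap w] at hr
      simp only [sub_apply, smul_apply, map_sub, map_smul, smul_eq_mul]
      linear_combination h - ω * hr
    · have hn := firstOrder_norm_axialReduce_le hA
      rw [← hω, ← hR] at hn
      have ha' : 0 < |a| := abs_pos.2 ha
      have h3' : ‖A (E4.basisVector 3)‖ = |a|⁻¹ * ‖a • A (E4.basisVector 3)‖ := by
        rw [norm_smul, Real.norm_eq_abs, ← mul_assoc, inv_mul_cancel₀ ha'.ne', one_mul]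
      rw [hnd']
      rw [h3'] at hn
      have hprod : 0 ≤ |a|⁻¹ * (‖A (E4.basisVector 0)‖ + ‖E4.spatial d‖) := by positivity
      nlinarith
    · have hker := firstOrder_lie_axial_eq_zero M a hy v w
      rw [← hRap y, ← hRap v, ← hRap w] at hker
      have hy' : A y + d = ((A - ω • R) y + d') + (ω • R y + d 0 • E4.basisVector 0) := by
        rw [sub_apply, smul_apply]
        conv_lhs => rw [hdsplit]
        abel
      have hv' : A v = (A - ω • R) v + ω • R v := by
        rw [sub_apply, smul_apply]; abel
      have hw' : A w = (A - ω • R) w + ω • R w := by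
        rw [sub_apply, smul_apply]; abel
      conv_lhs => rw [hy', hv', hw']
      simp only [map_add, map_smul, add_apply, smul_apply, smul_eq_mul,
        firstOrder_fderiv_kerr_basisVector_zero, zero_apply, mul_zero, add_zero]
      linear_combination ω * hker

/-- **Registered one-line carrier form** (`firstOrder_lie_reduce_D2`, stub (D) of the crux item) of
`firstOrder_lie_reduce`. [cite: ONeill1995, Ch. 2 §2.2] -/
theorem firstOrder_lie_reduce_D2 : open Literature.Geometry.Lorentzian in ∀ (M a : ℝ) {A : E4 →L[ℝ] E4}, (∀ u w : E4, Minkowski.bilin (A u) w + Minkowski.bilin u (A w) = 0) → ∀ d : E4, ∃ (A' : E4 →L[ℝ] E4) (d' : E4), (∀ u w : E4, Minkowski.bilin (A' u) w + Minkowski.bilin u (A' w) = 0) ∧ ‖A'‖ + ‖d'‖ ≤ 4 * (1 + |a|⁻¹) * (‖A (E4.basisVector 0)‖ + ‖E4.spatial d‖ + ‖a • A (E4.basisVector 3)‖) ∧ ∀ y : E4, 0 < Kerr.radius a y → ∀ v w : E4, fderiv ℝ (Kerr.bilin M a) y (A y + d) v w + Kerr.bilin M a y (A v) w + Kerr.bilin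 M a y v (A w) = fderiv ℝ (Kerr.bilin M a) y (A' y + d') v w + Kerr.bilin M a y (A' v) w + Kerr.bilin M a y v (A' w) :=
  fun M a _ hA d ↦ firstOrder_lie_reduce M a hA d

end Summit.FinalStateConjecture.FinalStateConjecture.Theorems.SublinearIsFree.Slaving

end
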